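import Literature.NumberTheory.EllipticCurves.EisensteinNewformLevelRaisingOddAssemblyProofs
import Literature.NumberTheory.EllipticCurves.EisensteinSeriesNebentypusLevelRaisedLargeWeight
import Literature.NumberTheory.ModularForms.CarayolLemma
import HarnessLib

/-!
# Billerey–Menares 2016, Thm. 2.2 (`p ≥ 5`): the named fact from Carayol's lemma BY NAME

Topic `Literature/NumberTheory/EllipticCurves`; namespace `Literature.NumberTheory.EllipticCurves`.
Proofs only (no definition, no named fact; D-0026).

The named fact `BillereyMenares2016_thm22_exists_newform` (`EisensteinNewformLevelRaising.lean`: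
N. Billerey, R. Menares, *On the modularity of reducible mod `l` Galois representations*, Math.
Res. Lett. 23 (2016), §2, Thm. 2.2 with Prop. 1.2, for `l = p ≥ 5`) was reduced in
`EisensteinNewformLevelRaisingOddAssemblyProofs.lean` to ONE input, the cuspidal congruence `hC`
of the printed proof (p. 7: "the reduction of `E` modulo `λ` is a cuspidal eigenform … by a
well-known lemma of Deligne and Serre there exists a cusp form"; in the 2018 sequel, §3.2: Katz's
`q`-expansion principle with Carayol's lemma): a cusp form `f₀ ∈ S_k(Γ₀(NM), χ)` congruent to the
level-raised Eisenstein series `F₂ = E_k^{𝟙,χ} - E_k^{𝟙,χ}(M·)` (`eisensteinLevelRaised N k χ M`)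
whenever all constant terms of `F₂` lie in the maximal ideal — by the theorem
`BillereyMenares2016_thm22_exists_newform_of_cuspidalCongruence (hC : …)`, every other step
(generalized Bernoulli numbers, constant terms at all cusps, the Galois/Dirichlet dictionary, the
Deligne–Serre lift, newform extraction at level `N ∣ N' ∣ NM`, the congruences at `ℓ = p` and
`ℓ = M`) being a theorem of the tree.

For `p ≥ 5` that input is an instance of the named fact
`Literature.NumberTheory.ModularForms.Carayol1989_cuspForm_lift` (`ModularForms/CarayolLemma.lean`;
Carayol 1989 §4.4, Edixhoven 1997 Lemma 1.9 and Prop. 1.10, Katz 1973 §1.6–1.8): `F₂` is a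
modular form on `Γ₁(NM)` of weight `k ≥ 3` with nebentypus `χ` (lifted to level `NM`) under
`Γ₀(NM)` (`eisensteinLevelRaised_slash_of_mem_gamma0`), `p`-integral `q`-expansion at `∞`
(`valuation_qExpansion_coeff_eisensteinLevelRaised_le_one_of_le`), `χ(-1) = (-1)^k`, and the order
of `χ` is prime to `p`.  This file records the reduction BY NAME, so that the dependency is an edge
of the tree:

* `cuspidalCongruence_of_carayol1989` — Carayol's lemma gives the cuspidal congruence `hC` at every
  prime `p ≥ 5`;
* `BillereyMenares2016_thm22_exists_newform_of_carayol1989` —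
  `Carayol1989_cuspForm_lift → BillereyMenares2016_thm22_exists_newform`.

Consequently `theorem BillereyMenares2016_thm22_exists_newform_holds :=
BillereyMenares2016_thm22_exists_newform_of_carayol1989 Carayol1989_cuspForm_lift_holds` is one
line as soon as `Carayol1989_cuspForm_lift_holds` exists.  (The variant for every ODD prime,
`BillereyMenares2016_thm22_exists_newform_odd`, needs the case `p = 3`, where Carayol's lemma is not
available — Edixhoven 1997, Prop. 1.10 and §4.3; it is reduced instead to the character-free input
of `EisensteinNewformLevelRaisingCuspFormLiftProofs.lean`, integral modular forms of weight `k ≥ 3`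
with an indicator constant term, by `BillereyMenares2016_thm22_exists_newform_odd_of_integralCuspIndicator`.)

## References

* N. Billerey, R. Menares, *On the modularity of reducible mod `l` Galois representations*, Math.
  Res. Lett. 23 (2016), 15–41, §2, Thm. 2.2 (p. 7), Prop. 1.2 (arXiv:1309.3717). [BillereyMenares2016]
* N. Billerey, R. Menares, *Strong modularity of reducible Galois representations*, Trans. Amer.
  Math. Soc. 370 (2018), 967–986, §3.2. [BillereyMenares2018]
* H. Carayol, *Sur les représentations galoisiennes modulo `ℓ` attachées aux formes modulaires*,
  Duke Math. J. 59 (1989), 785–801, §4.4. [Carayol1989]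
* B. Edixhoven, *Serre's conjecture*, in: Modular Forms and Fermat's Last Theorem (Cornell,
  Silverman, Stevens eds.), Springer (1997), 209–242, Lemma 1.9 and Prop. 1.10. [Edixhoven1997]
-/

noncomputable section

open scoped MatrixGroups ModularForm Topology
open CongruenceSubgroup UpperHalfPlane Filter

namespace Literature.NumberTheory.EllipticCurves

open Literature.NumberTheory.ModularForms
open Literature.NumberTheory.EllipticCurves.ModularForms

/-- **The cuspidal congruence of Billerey–Menares 2016, Thm. 2.2, from Carayol's lemma (`p ≥ 5`).**
For a prime `p ≥ 5`, `ι : ℚ̄_p ≃ ℂ`, a primitive Dirichlet character `χ mod N` (`p ∤ N`) of parity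
`(-1)^k` and order prime to `p`, a weight `k ≥ 3` and a prime `M ≠ p`: if every constant term of
the level-raised Eisenstein series `F₂ = eisensteinLevelRaised N k χ M` lies in the maximal ideal,
then `F₂` is congruent modulo the maximal ideal to a cusp form `f₀ ∈ S_k(Γ₁(NM))` of nebentypus
`χ` — the instance `L = NM`, `F = F₂` of `Carayol1989_cuspForm_lift` (`F₂` has nebentypus `χ` on
`Γ₀(NM)` and `p`-integral `q`-expansion).  This is the hypothesis `hC` of
`BillereyMenares2016_thm22_exists_newform_of_cuspidalCongruence` at `p ≥ 5` (where the weight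
window, `M ∤ N` and `χ(M)M^k ≡ 1` are not needed).
[cite: BillereyMenares2016, §2, proof of Thm. 2.2 (p. 7)] [cite: Carayol1989, §4.4]
[cite: Edixhoven1997, Lemma 1.9 and Prop. 1.10] -/
theorem cuspidalCongruence_of_carayol1989 (h : Carayol1989_cuspForm_lift)
    {p : ℕ} [Fact p.Prime] (ι : PadicAlgCl p ≃+* ℂ) {N : ℕ} [NeZero N]
    (χ : DirichletCharacter ℂ N) (k : ℕ) (hk : 3 ≤ k) (M : ℕ) [NeZero M]
    (hp5 : 5 ≤ p) (hχ : χ.IsPrimitive) (hpar : χ (-1) = (-1) ^ k) (hpN : ¬ p ∣ N) (hM : M.Prime)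
    (hMp : M ≠ p) (hord : ∃ m : ℕ, 0 < m ∧ ¬ p ∣ m ∧ χ ^ m = 1)
    (hcusps : ∀ γ : SL(2, ℤ), ∃ c : ℂ,
      Tendsto ((⇑(eisensteinLevelRaised N k χ M hk) : ℍ → ℂ) ∣[(k : ℤ)] γ) atImInfty (𝓝 c) ∧
        Valued.v (ι.symm c) < 1) :
    ∃ f₀ : CuspForm (Gamma1 (N * M)) k,
      f₀ ∈ nebentypusSubspace (N * M) k (DirichletCharacter.changeLevel (dvd_mul_right N M) χ) ∧
      ∀ n, Valued.v (ι.symm (cuspCoeff f₀ n -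
        (qExpansion 1 ⇑(eisensteinLevelRaised N k χ M hk)).coeff n)) < 1 := by
  have hp : p.Prime := Fact.out
  have hpM : ¬ p ∣ M := fun h' ↦ hMp ((Nat.prime_dvd_prime_iff_eq hp hM).1 h').symm
  have hpL : ¬ p ∣ N * M := fun h' ↦ (hp.dvd_mul.1 h').elim hpN hpM
  set F := eisensteinLevelRaised N k χ M hk with hF
  set χ' : DirichletCharacter ℂ (N * M) := DirichletCharacter.changeLevel (dvd_mul_right N M) χ
    with hχ'
  -- nebentypus `χ` on `Γ₀(NM)`
  have hslash : ∀ γ : SL(2, ℤ), γ ∈ Gamma0 (N * M) →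
      (⇑F : ℍ → ℂ) ∣[((k : ℕ) : ℤ)] γ = χ' ((γ 1 1 : ℤ) : ZMod (N * M)) • (⇑F : ℍ → ℂ) := by
    intro γ hγ
    rw [hF, eisensteinLevelRaised_slash_of_mem_gamma0 k χ M hk hγ]
    congr 1
    have hu := isUnit_gamma0_apply_one_one hγ
    rw [hχ', ← hu.unit_spec, DirichletCharacter.changeLevel_eq_cast_of_dvd χ (dvd_mul_right N M),
      hu.unit_spec, ZMod.cast_intCast (dvd_mul_right N M)]
  -- `p`-integral `q`-expansion at `∞`
  have hint : ∀ n : ℕ, Valued.v (ι.symm ((qExpansion 1 ⇑F).coeff n)) ≤ 1 := fun n ↦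
    valuation_qExpansion_coeff_eisensteinLevelRaised_le_one_of_le k χ M ι hk hχ hpar n
  -- parity and order of the lifted character
  have hpar' : χ' (-1) = (-1) ^ (k : ℤ) := by
    have h1 : ((-1 : (ZMod (N * M))ˣ) : ZMod (N * M)) = -1 := by rw [Units.val_neg, Units.val_one]
    rw [zpow_natCast, ← hpar, ← h1, hχ',
      DirichletCharacter.changeLevel_eq_cast_of_dvd χ (dvd_mul_right N M), h1,
      ZMod.cast_neg (dvd_mul_right N M), ZMod.cast_one (dvd_mul_right N M)]
  have hord' : ∃ m : ℕ, 0 < m ∧ ¬ p ∣ m ∧ χ' ^ m = 1 := by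
    obtain ⟨m, hm0, hpm, hχm⟩ := hord
    exact ⟨m, hm0, hpm, by rw [hχ', ← map_pow, hχm, map_one]⟩
  -- Carayol's lemma
  obtain ⟨G, hGχ, hGF⟩ := h p hp5 ι (N * M) hpL (k : ℤ)
    (by exact_mod_cast (show 2 ≤ k by omega)) χ' F hpar' hord' hslash hint hcusps
  exact ⟨G, hGχ, fun n ↦ hGF n⟩

/-- **Billerey–Menares 2016, Thm. 2.2 (`p ≥ 5`), from Carayol's lemma by name**: the named fact
`BillereyMenares2016_thm22_exists_newform` follows from the Katz–Carayol cuspidal lift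
`Carayol1989_cuspForm_lift` (the only input of the printed proof, §2 p. 7, that is not a theorem
of the tree), through `BillereyMenares2016_thm22_exists_newform_of_cuspidalCongruence` and
`cuspidalCongruence_of_carayol1989`.
[cite: BillereyMenares2016, §2, Thm. 2.2 (p. 7); Prop. 1.2] [cite: Carayol1989, §4.4]
[cite: Edixhoven1997, Lemma 1.9 and Prop. 1.10] -/
theorem BillereyMenares2016_thm22_exists_newform_of_carayol1989 (h : Carayol1989_cuspForm_lift) :
    BillereyMenares2016_thm22_exists_newform :=
  BillereyMenares2016_thm22_exists_newform_of_cuspidalCongruence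
    fun _ _ ι _ _ χ k hk M _ hp5 hχ hpar hpN hM _ hMp hord _ _ hcusps ↦
      cuspidalCongruence_of_carayol1989 h ι χ k hk M hp5 hχ hpar hpN hM hMp hord hcusps

end Literature.NumberTheory.EllipticCurves
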